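import Literature.Analysis.OperatorTheory.Enflo2023.CaseIIStage
import Literature.Analysis.OperatorTheory.Enflo2023.CaseIIExit
import Literature.Analysis.OperatorTheory.Enflo2023.CaseI
import HarnessLib

/-!
# Enflo (2023), Part A pp.12–13: THE run of (26) up to its first Case-I stage — what the Case I part receives

Source under adjudication: Per H. Enflo, *On the invariant subspace problem in Hilbert spaces*, arXiv:2305.15442
(v2, 2024), bib key `Enflo2023`.  [cite: Enflo2023, v2 p.12 (Case I, eq. (25); Case II, tex L386–L404), p.13
(eq. (26), the factor sentence tex L421–L431, "if Case II happens every time … So assume that we at some stage get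
Case I …", tex L443–L450), p.15 eq. (33) (the two-sided control with which the Main Construction starts)]

This module is os-F3b / BLOCK-2b repair-cell work (`pub-enflo`, formaliser 1, Part A): kernel-checked statements
ABOUT the manuscript's own iteration.  NOTHING here asserts the manuscript's main theorem; the only declarations
concluding `HasNontrivialClosedInvariantSubspace T` do so on the branch where the text itself stops ("Case II every
time", already `CaseII.caseI_exit_or_hasNontrivialClosedInvariantSubspace`, or a stage with `εθ = 0`).

THE QUESTION SETTLED HERE (packet STEPS S17 / B7, "INPUT NOT SECURED"; referee gen-17 §23.4 (i)): when THE run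
`y_{n+1} = ℓ'_n(T)y_n` of (26) — started at `y₀` with `‖T‖ ≤ 10⁻²⁰`, `‖x₀‖ = 1`, `0.3 ≤ ‖x₀ − y₀‖ ≤ 0.7`,
`(εθ)₀ ∈ [0, 10⁻⁴]` real, (9) at `y₀` — leaves Case II at its FIRST Case-I stage `N` (Case II as printed at every
`n < N`), what do (25), Lemma 2 and hence (33) receive at `y_N`?  The manuscript's own route supplies the factor
`(εθ)' < (1 − 1/20)εθ` via (27) at EVERY stage, including the exit stage `N − 1 → N`; (27) is false for THE
minimiser (`CaseII.eq27_false_for_minimal`) and the factor is only recovered from Case II at BOTH `n` and `n + 1`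
(`CaseII.factor_of_caseII_twice`), which is unavailable at the exit stage.  WHAT IS PROVED:

* `CaseII.run_state` — along any run: `(εθ)_n ≥ 0` real, `‖x₀ − y_n‖ ≤ 0.7`, `x₀ ≠ y_n` (activity of (1); no
  Case hypothesis);
* `CaseII.decay_before_exit` — `(εθ)_n ≤ 0.9491ⁿ(εθ)₀` for `n < N` (induction on `n`: the step `n → n + 1 < N`
  uses `CaseII.factor_of_caseII_twice`, which needs Case II at `n` AND at `n + 1`);
* `CaseII.exit_package` — at the exit stage: `(εθ)_N` real, `0 ≤ (εθ)_N ≤ 1.12(εθ)₀` (single-stage bound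
  `CaseII.stage_bounds_of_caseII`, NOT the factor), `0.3 − 2.2(εθ)₀ ≤ ‖x₀ − y_N‖ ≤ 0.7`, `‖y_N − y₀‖ ≤ 2.2(εθ)₀`
  (moves `≤ 0.11(εθ)_n` summed geometrically), `‖y_N‖ ≤ 1`, and (9) at `y_N`;
* `CaseII.exit_controls` — consequently, if `y₀` lies in the type-1 cone of v2 p.7 (19) (`Re⟨u₀, y₀⟩ ≥ ‖y₀‖/100`,
  `‖u₀‖ ≤ 1`; so `Re⟨u₀, y₀⟩ ≥ 0.00714 ≥ 0.003 + 2.2(εθ)₀`, as `‖y₀‖² = 1 − ‖x₀ − y₀‖² − 2(εθ)₀ ≥ 0.5098`) and stage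
  `N` is Case I (`|⟨x₀ − y_N, T^j y_N⟩| > ((εθ)_N)⁴`, some `j ≥ 1`), then `(εθ)_N > 0`, `y_N ∈ Lemma2.Adm u₀`
  (`‖y_N‖ ≤ 1`, `Re⟨u₀, y_N⟩ ≥ 0.003`), and THE minimal solution `c` of (1) for `V_{y_N}` at radius
  `‖x₀ − y_N‖` obeys BOTH Lemma 2 (`1 − γ((εθ)_N) ≤ |c₀|²`, `Σ_{j≥1}|c_j|² ≤ γ((εθ)_N)`, `Lemma2.lemma2_coeff`) AND
  (25) repaired (`Σ_{j≥1}|c_j|² ≥ (0.98·10²⁰)²((εθ)_N)^{22}`, `CaseI.tail_lower_bound_of_caseI`; and the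
  logarithmic form) — i.e. exactly the two-sided control (33) with which v2 p.15 starts, with `εθ := (εθ)_N`;
* `CaseII.eq33_at_exit` — the same packaged as the two-sided control (33) of v2 p.15 at the MC start vector:
  `1 − γ(εθ) ≤ |c₀|² ≤ 1 − 0.96·10⁴⁰(εθ)^{22}`, `0.96·10⁴⁰(εθ)^{22} ≤ Σ_{j≥1}|c_j|² ≤ γ(εθ)`, and the relative form
  `(1 − γ)‖c‖² ≤ |c₀|²` consumed by `Eq40.eq40_of_eq33` (`εθ = (εθ)_N`; printed: `(εθ)^{15}` and `(3γ^{1/2})∘(3γ^{1/2})`);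
* `CaseII.first_caseI_stage_or_hasNontrivialClosedInvariantSubspace` — THE run either yields a non-trivial
  closed invariant subspace (Case II for ever, or a stage with `εθ = 0`) or has a first Case-I stage `N` with
  Case II printed and `(εθ)_n > 0` at all `n < N` — the hypotheses of `exit_package` / `exit_controls`.

VERDICT for S17/B7: the exit input IS secured WITHOUT (27) and without the factor at the exit stage — nothing that
fails there is load-bearing; the price is the constant `1.12` in `(εθ)_N ≤ 1.12(εθ)₀` (harmless: (33) is stated
for the current `εθ`).  The only inputs are the text's standing normalisations at `y₀ = y₁'`: the window
`0.3 ≤ ‖x₀ − y₁'‖ ≤ 0.7`, `(εθ)₀ ≤ 10⁻⁴`, (9) at `y₁'` (a minimal move, p.3) and the type-1 cone (19) (p.7).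

Origin: planner-b2b-enflo-1-g8-0 (F1 gen-8), 2026-08-19.
-/

noncomputable section

open scoped InnerProductSpace ENNReal
open Literature.Analysis.UnboundedOperators (inner_self_eq_coe_norm_sq)

namespace Literature.Analysis.OperatorTheory.Enflo2023

variable {H : Type*} [NormedAddCommGroup H] [InnerProductSpace ℂ H] [CompleteSpace H]

namespace CaseII

open Vy Lemma2

/-- **State invariants along any run of (26)** (no Case hypothesis): `‖x₀‖ = 1`, `0.3 ≤ ‖x₀ − y₀‖ ≤ 0.7`,
`(εθ)₀ ≥ 0` real.  Then at every stage `(εθ)_n ≥ 0` is real, `‖x₀ − y_n‖ ≤ 0.7` and `x₀ ≠ y_n` (the constraint of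
(1) is active at every stage; a stage with `x₀ = y_{n+1}` would force `(εθ)_n = 0` and `x₀ = y_n`).  Extracted from
the proof of `hasNontrivialClosedInvariantSubspace_of_caseII_along_runs`. [cite: Enflo2023, v2 p.13, eq. (26); pp.2–3, (1), (5), (6)] -/
theorem run_state (T : H →L[ℂ] H) (hT : ‖T‖ < 1) (x₀ y₀ : H) (hx₀ : ‖x₀‖ = 1)
    (hwin : 0.3 ≤ ‖x₀ - y₀‖ ∧ ‖x₀ - y₀‖ ≤ 0.7) (him : (⟪x₀ - y₀, y₀⟫_ℂ).im = 0)
    (ht0 : 0 ≤ (⟪x₀ - y₀, y₀⟫_ℂ).re) (y : ℕ → H) (a : ℕ → ℓ2) (hy0 : y 0 = y₀)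
    (hy : ∀ n, IsMinimal (V T hT (y n)) x₀ ‖x₀ - ((1 + (⟪x₀ - y n, y n⟫_ℂ).re / 10 : ℝ) : ℂ) • y n‖ (a n) ∧
      y (n + 1) = V T hT (y n) (a n)) :
    ∀ n, 0 ≤ (⟪x₀ - y n, y n⟫_ℂ).re ∧ ‖x₀ - y n‖ ≤ 0.7 ∧ (⟪x₀ - y n, y n⟫_ℂ).im = 0 ∧ x₀ - y n ≠ 0 := by
  subst hy0
  have hS : ∀ n, 0 ≤ (⟪x₀ - y n, y n⟫_ℂ).re ∧ ‖x₀ - y n‖ ≤ 0.7 ∧ (⟪x₀ - y n, y n⟫_ℂ).im = 0 := by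
    intro n
    induction n with
    | zero => exact ⟨ht0, hwin.2, him⟩
    | succ m ih =>
      obtain ⟨hm0, hmd, -⟩ := ih
      have hy1 : ‖y m‖ ≤ 1 := norm_move_le_one x₀ (y m) hx₀ hm0
      have hY1 : ‖y m‖ ^ 2 ≤ 1 := pow_le_one₀ (norm_nonneg _) hy1
      have hrad : ‖x₀ - ((1 + (⟪x₀ - y m, y m⟫_ℂ).re / 10 : ℝ) : ℂ) • y m‖ ≤ ‖x₀ - y m‖ :=
        radius_le_norm_sub x₀ (y m) _ rfl (by linarith only [hY1])
      have hrad1 : ‖x₀ - ((1 + (⟪x₀ - y m, y m⟫_ℂ).re / 10 : ℝ) : ℂ) • y m‖ < ‖x₀‖ := by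
        rw [hx₀]; linarith only [hrad, hmd]
      obtain ⟨C, hC0, hC⟩ := (hy m).1.kkt ((hy m).1.ne_zero hrad1)
      have h6 := IsMinimal.eq6 hC
      rw [(hy m).2, h6, Complex.ofReal_re, Complex.ofReal_im, (hy m).1.norm_sub_eq hrad1]
      exact ⟨mul_nonneg hC0 (sq_nonneg _), le_trans hrad hmd, rfl⟩
  have hR : ∀ n, x₀ - y n ≠ 0 := by
    intro n
    induction n with
    | zero =>
      intro h
      have : ‖x₀ - y 0‖ = 0 := by rw [h, norm_zero]
      linarith only [hwin.1, this]
    | succ m ih =>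
      intro h
      obtain ⟨hm0, hmd, -⟩ := hS m
      have hminm := (hy m).1
      have hy1 : ‖y m‖ ≤ 1 := norm_move_le_one x₀ (y m) hx₀ hm0
      have hY1 : ‖y m‖ ^ 2 ≤ 1 := pow_le_one₀ (norm_nonneg _) hy1
      generalize ht : (⟪x₀ - y m, y m⟫_ℂ).re = t at hminm hm0
      have hrad : ‖x₀ - ((1 + t / 10 : ℝ) : ℂ) • y m‖ ≤ ‖x₀ - y m‖ :=
        radius_le_norm_sub x₀ (y m) t ht (by linarith only [hY1])
      have hrad1 : ‖x₀ - ((1 + t / 10 : ℝ) : ℂ) • y m‖ < ‖x₀‖ := by rw [hx₀]; linarith only [hrad, hmd]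
      have hact := hminm.norm_sub_eq hrad1
      rw [← (hy m).2, h, norm_zero] at hact
      have hx : x₀ = ((1 + t / 10 : ℝ) : ℂ) • y m := sub_eq_zero.1 (norm_eq_zero.1 hact.symm)
      have hxy : x₀ - y m = ((t / 10 : ℝ) : ℂ) • y m := by
        rw [hx, show ((1 + t / 10 : ℝ) : ℂ) = 1 + ((t / 10 : ℝ) : ℂ) by push_cast; ring, add_smul, one_smul,
          add_sub_cancel_left]
      have key : t / 10 * ‖y m‖ ^ 2 = t := by
        have h1 := ht
        rw [hxy, inner_smul_left, inner_self_eq_coe_norm_sq, Complex.conj_ofReal, ← Complex.ofReal_mul,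
          Complex.ofReal_re] at h1
        exact h1
      have hle : t / 10 * ‖y m‖ ^ 2 ≤ t / 10 * 1 := mul_le_mul_of_nonneg_left hY1 (by linarith only [hm0])
      have ht0' : t = 0 := by linarith only [key, hle, hm0]
      apply ih
      rw [hxy, ht0']; simp
  exact fun n => ⟨(hS n).1, (hS n).2.1, (hS n).2.2, hR n⟩

/-- **Geometric decay before the exit.**  If Case II as printed (`|⟨x₀ − y_n, T^j y_n⟩| ≤ ((εθ)_n)⁴`, `j ≥ 1`)
holds and `(εθ)_n > 0` at every stage `n < N` of a run of (26) (`‖T‖ ≤ 10⁻²⁰`, `(εθ)₀ ≤ 10⁻⁴`), then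
`(εθ)_n ≤ 0.9491ⁿ·(εθ)₀` for all `n < N`: the factor `CaseII.factor_of_caseII_twice` needs Case II at `n` AND
`n + 1`, available exactly while `n + 1 < N`. [cite: Enflo2023, v2 p.13, tex L421–L443 (the factor and the Case II branch)] -/
theorem decay_before_exit (T : H →L[ℂ] H) (hT : ‖T‖ < 1) (hT20 : ‖T‖ ≤ 1 / 10 ^ 20) (x₀ y₀ : H)
    (hx₀ : ‖x₀‖ = 1) (hwin : 0.3 ≤ ‖x₀ - y₀‖ ∧ ‖x₀ - y₀‖ ≤ 0.7) (him : (⟪x₀ - y₀, y₀⟫_ℂ).im = 0)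
    (ht0 : 0 ≤ (⟪x₀ - y₀, y₀⟫_ℂ).re) (ht1 : (⟪x₀ - y₀, y₀⟫_ℂ).re ≤ 1 / 10 ^ 4)
    (y : ℕ → H) (a : ℕ → ℓ2) (hy0 : y 0 = y₀)
    (hy : ∀ n, IsMinimal (V T hT (y n)) x₀ ‖x₀ - ((1 + (⟪x₀ - y n, y n⟫_ℂ).re / 10 : ℝ) : ℂ) • y n‖ (a n) ∧
      y (n + 1) = V T hT (y n) (a n))
    (N : ℕ) (hII : ∀ n, n < N → ∀ j, 1 ≤ j → ‖⟪x₀ - y n, (T ^ j) (y n)⟫_ℂ‖ ≤ (⟪x₀ - y n, y n⟫_ℂ).re ^ 4)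
    (hpos : ∀ n, n < N → 0 < (⟪x₀ - y n, y n⟫_ℂ).re) :
    ∀ n, n < N → (⟪x₀ - y n, y n⟫_ℂ).re ≤ 0.9491 ^ n * (⟪x₀ - y₀, y₀⟫_ℂ).re := by
  have hS := run_state T hT x₀ y₀ hx₀ hwin him ht0 y a hy0 hy
  subst hy0
  have ht_re : ∀ n, ⟪x₀ - y n, y n⟫_ℂ = (((⟪x₀ - y n, y n⟫_ℂ).re : ℝ) : ℂ) := fun n =>
    Complex.ext (by rw [Complex.ofReal_re]) (by rw [Complex.ofReal_im]; exact (hS n).2.2.1)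
  intro n
  induction n with
  | zero => intro _; rw [pow_zero, one_mul]
  | succ m ih =>
    intro hm
    have hm' : m < N := by omega
    have hdm := ih hm'
    have hr1 : (0.9491 : ℝ) ^ m ≤ 1 := pow_le_one₀ (by norm_num) (by norm_num)
    have hsm : (⟪x₀ - y m, y m⟫_ℂ).re ≤ 1 / 10 ^ 4 := by
      have := mul_le_mul_of_nonneg_right hr1 ht0
      linarith only [hdm, this, ht1]
    have hII' : ∀ j, 1 ≤ j → ‖⟪x₀ - V T hT (y m) (a m), (T ^ j) (V T hT (y m) (a m))⟫_ℂ‖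
        ≤ (⟪x₀ - V T hT (y m) (a m), V T hT (y m) (a m)⟫_ℂ).re ^ 4 := by
      intro j hj; have := hII (m + 1) hm j hj; rwa [(hy m).2] at this
    have h := factor_of_caseII_twice T hT hT20 x₀ (y m) _ (a m) hx₀ (ht_re m) (hpos m hm') hsm (hS m).2.1
      (hII m hm') (hy m).1 hII'
    rw [← (hy m).2] at h
    have hstep : 0.9491 * (⟪x₀ - y m, y m⟫_ℂ).re ≤ 0.9491 * (0.9491 ^ m * (⟪x₀ - y 0, y 0⟫_ℂ).re) :=
      mul_le_mul_of_nonneg_left hdm (by norm_num)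
    calc (⟪x₀ - y (m + 1), y (m + 1)⟫_ℂ).re ≤ 0.9491 * (⟪x₀ - y m, y m⟫_ℂ).re := h
      _ ≤ 0.9491 * (0.9491 ^ m * (⟪x₀ - y 0, y 0⟫_ℂ).re) := hstep
      _ = 0.9491 ^ (m + 1) * (⟪x₀ - y 0, y 0⟫_ℂ).re := by ring

/-- **The exit package.**  THE run of (26) from `y₀` (`‖T‖ ≤ 10⁻²⁰`, `‖x₀‖ = 1`, `0.3 ≤ ‖x₀ − y₀‖ ≤ 0.7`,
`(εθ)₀ ∈ [0, 10⁻⁴]` real, (9) at `y₀`), with Case II as printed and `(εθ)_n > 0` at every stage `n < N`.  Then at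
stage `N`: `(εθ)_N` is real with `0 ≤ (εθ)_N ≤ 1.12(εθ)₀` (the single-stage bound of `stage_bounds_of_caseII` at
`N − 1`; NOT the factor, which is unavailable there), `0.3 − 2.2(εθ)₀ ≤ ‖x₀ − y_N‖ ≤ 0.7`, `‖y_N − y₀‖ ≤ 2.2(εθ)₀`,
`‖y_N‖ ≤ 1`, and (9) holds at `y_N` with `t = (εθ)_N`. [cite: Enflo2023, v2 p.13, eq. (26) and tex L443–L450 ("assume that we at some stage get Case I"); p.3 eq. (9)] -/
theorem exit_package (T : H →L[ℂ] H) (hT : ‖T‖ < 1) (hT20 : ‖T‖ ≤ 1 / 10 ^ 20) (x₀ y₀ : H)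
    (hx₀ : ‖x₀‖ = 1) (hwin : 0.3 ≤ ‖x₀ - y₀‖ ∧ ‖x₀ - y₀‖ ≤ 0.7) (him : (⟪x₀ - y₀, y₀⟫_ℂ).im = 0)
    (ht0 : 0 ≤ (⟪x₀ - y₀, y₀⟫_ℂ).re) (ht1 : (⟪x₀ - y₀, y₀⟫_ℂ).re ≤ 1 / 10 ^ 4)
    (h9 : ∀ m : ℕ, ‖⟪x₀ - y₀, (T ^ m) y₀⟫_ℂ‖ ≤ (⟪x₀ - y₀, y₀⟫_ℂ).re)
    (y : ℕ → H) (a : ℕ → ℓ2) (hy0 : y 0 = y₀)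
    (hy : ∀ n, IsMinimal (V T hT (y n)) x₀ ‖x₀ - ((1 + (⟪x₀ - y n, y n⟫_ℂ).re / 10 : ℝ) : ℂ) • y n‖ (a n) ∧
      y (n + 1) = V T hT (y n) (a n))
    (N : ℕ) (hII : ∀ n, n < N → ∀ j, 1 ≤ j → ‖⟪x₀ - y n, (T ^ j) (y n)⟫_ℂ‖ ≤ (⟪x₀ - y n, y n⟫_ℂ).re ^ 4)
    (hpos : ∀ n, n < N → 0 < (⟪x₀ - y n, y n⟫_ℂ).re) :
    (⟪x₀ - y N, y N⟫_ℂ).im = 0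
    ∧ 0 ≤ (⟪x₀ - y N, y N⟫_ℂ).re
    ∧ (⟪x₀ - y N, y N⟫_ℂ).re ≤ 1.12 * (⟪x₀ - y₀, y₀⟫_ℂ).re
    ∧ ‖x₀ - y N‖ ≤ 0.7
    ∧ 0.3 - 2.2 * (⟪x₀ - y₀, y₀⟫_ℂ).re ≤ ‖x₀ - y N‖
    ∧ ‖y N - y₀‖ ≤ 2.2 * (⟪x₀ - y₀, y₀⟫_ℂ).re
    ∧ ‖y N‖ ≤ 1
    ∧ (∀ m : ℕ, ‖⟪x₀ - y N, (T ^ m) (y N)⟫_ℂ‖ ≤ (⟪x₀ - y N, y N⟫_ℂ).re) := by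
  have hS := run_state T hT x₀ y₀ hx₀ hwin him ht0 y a hy0 hy
  have hdec := decay_before_exit T hT hT20 x₀ y₀ hx₀ hwin him ht0 ht1 y a hy0 hy N hII hpos
  subst hy0
  have ht_re : ∀ n, ⟪x₀ - y n, y n⟫_ℂ = (((⟪x₀ - y n, y n⟫_ℂ).re : ℝ) : ℂ) := fun n =>
    Complex.ext (by rw [Complex.ofReal_re]) (by rw [Complex.ofReal_im]; exact (hS n).2.2.1)
  -- the single-stage bounds at every stage `n < N`
  have hstage : ∀ n, n < N → ‖y (n + 1) - y n‖ ≤ 0.11 * (⟪x₀ - y n, y n⟫_ℂ).re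
      ∧ (⟪x₀ - y (n + 1), y (n + 1)⟫_ℂ).re ≤ 1.12 * (⟪x₀ - y n, y n⟫_ℂ).re
      ∧ ∀ m : ℕ, ‖⟪x₀ - y (n + 1), (T ^ m) (y (n + 1))⟫_ℂ‖ ≤ (⟪x₀ - y (n + 1), y (n + 1)⟫_ℂ).re := by
    intro n hn
    have hr1 : (0.9491 : ℝ) ^ n ≤ 1 := pow_le_one₀ (by norm_num) (by norm_num)
    have hsn : (⟪x₀ - y n, y n⟫_ℂ).re ≤ 1 / 10 ^ 4 := by
      have := mul_le_mul_of_nonneg_right hr1 ht0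
      linarith only [hdec n hn, this, ht1]
    obtain ⟨hmove, -, -, hup, -, -, h9'⟩ := stage_bounds_of_caseII T hT hT20 x₀ (y n) _ (a n) hx₀ (ht_re n)
      (hpos n hn) hsn (hS n).2.1 (hII n hn) (hy n).1
    rw [← (hy n).2] at hmove hup h9'
    exact ⟨hmove, hup, h9'⟩
  -- the telescoped displacement `‖y_n − y₀‖ ≤ 2.2(εθ)₀(1 − 0.9491ⁿ)` for `n ≤ N`
  have hdisp : ∀ n, n ≤ N → ‖y n - y 0‖ ≤ 2.2 * (⟪x₀ - y 0, y 0⟫_ℂ).re * (1 - 0.9491 ^ n) := by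
    intro n
    induction n with
    | zero => intro _; simp
    | succ m ih =>
      intro hm
      have hm' : m < N := by omega
      have h1 := ih hm'.le
      have h2 := (hstage m hm').1
      have h3 : 0.11 * (⟪x₀ - y m, y m⟫_ℂ).re ≤ 0.11 * (0.9491 ^ m * (⟪x₀ - y 0, y 0⟫_ℂ).re) :=
        mul_le_mul_of_nonneg_left (hdec m hm') (by norm_num)
      have hP : 0 ≤ 0.9491 ^ m * (⟪x₀ - y 0, y 0⟫_ℂ).re := mul_nonneg (pow_nonneg (by norm_num) m) ht0
      have hpow : (0.9491 : ℝ) ^ (m + 1) * (⟪x₀ - y 0, y 0⟫_ℂ).re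
          = 0.9491 * (0.9491 ^ m * (⟪x₀ - y 0, y 0⟫_ℂ).re) := by ring
      calc ‖y (m + 1) - y 0‖ ≤ ‖y (m + 1) - y m‖ + ‖y m - y 0‖ := norm_sub_le_norm_sub_add_norm_sub _ _ _
        _ ≤ 2.2 * (⟪x₀ - y 0, y 0⟫_ℂ).re * (1 - 0.9491 ^ (m + 1)) := by
            have : 2.2 * (⟪x₀ - y 0, y 0⟫_ℂ).re * (1 - 0.9491 ^ (m + 1))
                = 2.2 * (⟪x₀ - y 0, y 0⟫_ℂ).re - 2.2 * (0.9491 ^ (m + 1) * (⟪x₀ - y 0, y 0⟫_ℂ).re) := by ring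
            rw [this, hpow]
            have : 2.2 * (⟪x₀ - y 0, y 0⟫_ℂ).re * (1 - 0.9491 ^ m)
                = 2.2 * (⟪x₀ - y 0, y 0⟫_ℂ).re - 2.2 * (0.9491 ^ m * (⟪x₀ - y 0, y 0⟫_ℂ).re) := by ring
            rw [this] at h1
            linarith only [h1, h2, h3, hP]
  have hyN1 : ‖y N‖ ≤ 1 := norm_move_le_one x₀ (y N) hx₀ (hS N).1
  have hdN : ‖y N - y 0‖ ≤ 2.2 * (⟪x₀ - y 0, y 0⟫_ℂ).re := by
    have h := hdisp N le_rfl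
    have hP : 0 ≤ 2.2 * (⟪x₀ - y 0, y 0⟫_ℂ).re * 0.9491 ^ N := by positivity
    linarith only [h, hP]
  have hlow : 0.3 - 2.2 * (⟪x₀ - y 0, y 0⟫_ℂ).re ≤ ‖x₀ - y N‖ := by
    have h := norm_sub_le_norm_sub_add_norm_sub x₀ (y N) (y 0)
    linarith only [h, hdN, hwin.1]
  refine ⟨(hS N).2.2.1, (hS N).1, ?_, (hS N).2.1, hlow, hdN, hyN1, ?_⟩
  · cases N with
    | zero => linarith only [ht0]
    | succ k =>
      have hk : k < k + 1 := Nat.lt_succ_self k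
      have hr1 : (0.9491 : ℝ) ^ k ≤ 1 := pow_le_one₀ (by norm_num) (by norm_num)
      have h1 := (hstage k hk).2.1
      have h2 := hdec k hk
      have h3 := mul_le_mul_of_nonneg_right hr1 ht0
      linarith only [h1, h2, h3, (hpos k hk).le]
  · cases N with
    | zero => exact h9
    | succ k => exact (hstage k (Nat.lt_succ_self k)).2.2

/-- **What the Case I part receives at the exit stage ((33)'s two inputs, kernel form).**  In the setting of
`exit_package`, let moreover `y₀` lie in the type-1 cone (19) — `‖u₀‖ ≤ 1`, `Re⟨u₀, y₀⟩ ≥ ‖y₀‖/100` (hence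
`≥ 0.00714 ≥ 0.003 + 2.2(εθ)₀`, since `‖y₀‖² = 1 − ‖x₀ − y₀‖² − 2(εθ)₀ ≥ 0.5098`) — and let stage `N` be Case I:
`|⟨x₀ − y_N, T^j y_N⟩| > ((εθ)_N)⁴` for some `j ≥ 1`.  Then `(εθ)_N > 0`, `y_N ∈ Adm u₀` (`Re⟨u₀, y_N⟩ ≥ 0.003`:
the run moved by `≤ 2.2(εθ)₀`), and for THE minimal solution `c` of (1) for `V_{y_N}` at radius
`‖x₀ − y_N‖`: Lemma 2 — `1 − γ((εθ)_N) ≤ |c₀|²` and `Σ_{j≥1}|c_j|² ≤ γ((εθ)_N)` — AND (25) repaired —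
`(Σ_{j≥1}|c_j|²)^{1/2} ≥ 0.98·10²⁰((εθ)_N)^{11}` and `(m + 2)(Σ_{j≥1}|c_j|²)^{1/2} ≥ 0.99((εθ)_N)^{10}`.  No (27), no
factor at the exit stage. [cite: Enflo2023, v2 p.12 eq. (25), pp.10–11 Lemma 2, p.7 eq. (19), p.15 eq. (33)] -/
theorem exit_controls (T : H →L[ℂ] H) (hT : ‖T‖ < 1) (hT20 : ‖T‖ ≤ 1 / 10 ^ 20) (x₀ y₀ : H)
    (hx₀ : ‖x₀‖ = 1) (hwin : 0.3 ≤ ‖x₀ - y₀‖ ∧ ‖x₀ - y₀‖ ≤ 0.7) (him : (⟪x₀ - y₀, y₀⟫_ℂ).im = 0)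
    (ht0 : 0 ≤ (⟪x₀ - y₀, y₀⟫_ℂ).re) (ht1 : (⟪x₀ - y₀, y₀⟫_ℂ).re ≤ 1 / 10 ^ 4)
    (h9 : ∀ m : ℕ, ‖⟪x₀ - y₀, (T ^ m) y₀⟫_ℂ‖ ≤ (⟪x₀ - y₀, y₀⟫_ℂ).re)
    (y : ℕ → H) (a : ℕ → ℓ2) (hy0 : y 0 = y₀)
    (hy : ∀ n, IsMinimal (V T hT (y n)) x₀ ‖x₀ - ((1 + (⟪x₀ - y n, y n⟫_ℂ).re / 10 : ℝ) : ℂ) • y n‖ (a n) ∧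
      y (n + 1) = V T hT (y n) (a n))
    (N : ℕ) (hII : ∀ n, n < N → ∀ j, 1 ≤ j → ‖⟪x₀ - y n, (T ^ j) (y n)⟫_ℂ‖ ≤ (⟪x₀ - y n, y n⟫_ℂ).re ^ 4)
    (hpos : ∀ n, n < N → 0 < (⟪x₀ - y n, y n⟫_ℂ).re)
    (u₀ : H) (hu₀ : ‖u₀‖ ≤ 1) (hA : ‖y₀‖ / 100 ≤ (⟪u₀, y₀⟫_ℂ).re)
    (hI : ∃ j, 1 ≤ j ∧ (⟪x₀ - y N, y N⟫_ℂ).re ^ 4 < ‖⟪x₀ - y N, (T ^ j) (y N)⟫_ℂ‖)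
    {c : ℓ2} (hc : IsMinimal (V T hT (y N)) x₀ ‖x₀ - y N‖ c) :
    0 < (⟪x₀ - y N, y N⟫_ℂ).re
    ∧ y N ∈ Adm u₀
    ∧ 1 - gammaEps T hT u₀ (⟪x₀ - y N, y N⟫_ℂ).re ≤ ‖c 0‖ ^ 2
    ∧ ‖L c‖ ^ 2 ≤ gammaEps T hT u₀ (⟪x₀ - y N, y N⟫_ℂ).re
    ∧ ‖c‖ ^ 2 ≤ 1 - 1.99 * (⟪x₀ - y N, y N⟫_ℂ).re ^ 10
    ∧ 98 / 100 * 10 ^ 20 * (⟪x₀ - y N, y N⟫_ℂ).re ^ 11 ≤ ‖L c‖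
    ∧ 99 / 100 * (⟪x₀ - y N, y N⟫_ℂ).re ^ 10 ≤ (mIdx (⟪x₀ - y N, y N⟫_ℂ).re + 2) * ‖L c‖ := by
  obtain ⟨himN, ht0N, hupN, hdN, -, hdisp, hyN1, h9N⟩ :=
    exit_package T hT hT20 x₀ y₀ hx₀ hwin him ht0 ht1 h9 y a hy0 hy N hII hpos
  subst hy0
  obtain ⟨j, hj, hjlt⟩ := hI
  have htN : 0 < (⟪x₀ - y N, y N⟫_ℂ).re := by
    rcases ht0N.lt_or_eq with h | h
    · exact h
    · exfalso
      have hre0 : (⟪x₀ - y N, y N⟫_ℂ).re = 0 := h.symm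
      have h4 : (⟪x₀ - y N, y N⟫_ℂ).re ^ 4 = 0 := by rw [hre0]; norm_num
      linarith only [h9N j, hjlt, h4, hre0]
  have hA' : y N ∈ Adm u₀ := by
    refine ⟨hyN1, ?_⟩
    -- the cone (19) gives the margin: `‖y₀‖² = 1 − ‖x₀ − y₀‖² − 2(εθ)₀ ≥ 0.5098`, so `‖y₀‖/100 ≥ 0.00714`
    have hysq : ‖y 0‖ ^ 2 = 1 - ‖x₀ - y 0‖ ^ 2 - 2 * (⟪x₀ - y 0, y 0⟫_ℂ).re := norm_sq_move x₀ (y 0) hx₀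
    have hY : 0.5098 ≤ ‖y 0‖ ^ 2 := by
      rw [hysq]
      linarith only [mul_le_mul hwin.2 hwin.2 (norm_nonneg _) (by norm_num : (0:ℝ) ≤ 0.7), ht1]
    have hyge : 0.714 ≤ ‖y 0‖ := by
      by_contra hcon
      push Not at hcon
      have h1 : ‖y 0‖ ^ 2 < 0.714 ^ 2 := pow_lt_pow_left₀ hcon (norm_nonneg _) two_ne_zero
      linarith only [hY, h1]
    have hmargin : 3 / 1000 + 2.2 * (⟪x₀ - y 0, y 0⟫_ℂ).re ≤ (⟪u₀, y 0⟫_ℂ).re := by linarith only [hA, hyge, ht1]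
    have hsplit : ⟪u₀, y N⟫_ℂ = ⟪u₀, y 0⟫_ℂ + ⟪u₀, y N - y 0⟫_ℂ := by
      rw [← inner_add_right]; congr 1; abel
    have hb : ‖⟪u₀, y N - y 0⟫_ℂ‖ ≤ 1 * (2.2 * (⟪x₀ - y 0, y 0⟫_ℂ).re) :=
      le_trans (norm_inner_le_norm _ _) (mul_le_mul hu₀ hdisp (norm_nonneg _) zero_le_one)
    have hre : -(1 * (2.2 * (⟪x₀ - y 0, y 0⟫_ℂ).re)) ≤ (⟪u₀, y N - y 0⟫_ℂ).re :=
      le_trans (neg_le_neg hb) (neg_le_of_abs_le (Complex.abs_re_le_norm _))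
    rw [hsplit, Complex.add_re]
    linarith only [hmargin, hre]
  have hTK : ‖T‖ ≤ 1 / bigK := by unfold bigK; exact hT20
  have hxy : ‖x₀ - y N‖ ≤ 1 := by linarith only [hdN]
  have hlt : ‖x₀ - y N‖ < ‖x₀‖ := by rw [hx₀]; linarith only [hdN]
  have htC : ⟪x₀ - y N, y N⟫_ℂ = (((⟪x₀ - y N, y N⟫_ℂ).re : ℝ) : ℂ) :=
    Complex.ext (by rw [Complex.ofReal_re]) (by rw [Complex.ofReal_im]; exact himN)
  have ht3 : (⟪x₀ - y N, y N⟫_ℂ).re ≤ 1 / 10 ^ 3 := by linarith only [hupN, ht1, ht0]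
  have hI' : ∃ j, 1 ≤ j ∧ (⟪x₀ - y N, y N⟫_ℂ).re ^ 4 ≤ ‖⟪x₀ - y N, (T ^ j) (y N)⟫_ℂ‖ := ⟨j, hj, hjlt.le⟩
  obtain ⟨hL2a, hL2b⟩ := lemma2_coeff T hT hTK hA' hxy htN h9N hc
  exact ⟨htN, hA', hL2a, hL2b, CaseI.norm_sq_le_of_caseI T hT hT20 x₀ (y N) _ htC htN ht3 hyN1 hI' hc,
    CaseI.tail_lower_bound_of_caseI T hT hT20 x₀ (y N) _ htC htN ht3 hyN1 hxy hlt hI' hc,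
    CaseI.tail_lower_bound_of_caseI_h9 T hT hT20 x₀ (y N) _ htC htN ht3 hyN1 hxy hlt hI' h9N hc⟩

/-- **(33) at the start of the Main Construction (v2 p.15), kernel form.**  In the setting of `exit_controls`
(THE run of (26) from `y₁'`, first Case-I stage `N`, `c` THE minimal solution of (1) for `V_{y_N}` at radius
`‖x₀ − y_N‖`, `εθ := (εθ)_N`): the head and the tail of `c` are squeezed two-sidedly —
`1 − γ(εθ) ≤ |c₀|² ≤ 1 − 0.96·10⁴⁰(εθ)^{22}`, `0.96·10⁴⁰(εθ)^{22} ≤ Σ_{j≥1}|c_j|² ≤ γ(εθ)` — and, in the relative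
form in which (33) is consumed downstream (`Eq40.eq40_of_eq33`, hypothesis `(1 − γ)‖a‖² ≤ |a₀|²`),
`(1 − γ(εθ))‖c‖² ≤ |c₀|²`.  The printed (33) has `(εθ)^{15}` on the upper side (from the printed (25)) and
`[(3γ^{1/2})∘(3γ^{1/2})](εθ)` on the lower side (Lemmas 3–5, for the MODIFIED vectors of the construction); at
the start vector itself Lemma 2 gives `γ`.  [cite: Enflo2023, v2 p.15, eq. (33), tex L535–L537; p.12 eq. (25); pp.10–11 Lemma 2] -/
theorem eq33_at_exit (T : H →L[ℂ] H) (hT : ‖T‖ < 1) (hT20 : ‖T‖ ≤ 1 / 10 ^ 20) (x₀ y₀ : H)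
    (hx₀ : ‖x₀‖ = 1) (hwin : 0.3 ≤ ‖x₀ - y₀‖ ∧ ‖x₀ - y₀‖ ≤ 0.7) (him : (⟪x₀ - y₀, y₀⟫_ℂ).im = 0)
    (ht0 : 0 ≤ (⟪x₀ - y₀, y₀⟫_ℂ).re) (ht1 : (⟪x₀ - y₀, y₀⟫_ℂ).re ≤ 1 / 10 ^ 4)
    (h9 : ∀ m : ℕ, ‖⟪x₀ - y₀, (T ^ m) y₀⟫_ℂ‖ ≤ (⟪x₀ - y₀, y₀⟫_ℂ).re)
    (y : ℕ → H) (a : ℕ → ℓ2) (hy0 : y 0 = y₀)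
    (hy : ∀ n, IsMinimal (V T hT (y n)) x₀ ‖x₀ - ((1 + (⟪x₀ - y n, y n⟫_ℂ).re / 10 : ℝ) : ℂ) • y n‖ (a n) ∧
      y (n + 1) = V T hT (y n) (a n))
    (N : ℕ) (hII : ∀ n, n < N → ∀ j, 1 ≤ j → ‖⟪x₀ - y n, (T ^ j) (y n)⟫_ℂ‖ ≤ (⟪x₀ - y n, y n⟫_ℂ).re ^ 4)
    (hpos : ∀ n, n < N → 0 < (⟪x₀ - y n, y n⟫_ℂ).re)
    (u₀ : H) (hu₀ : ‖u₀‖ ≤ 1) (hA : ‖y₀‖ / 100 ≤ (⟪u₀, y₀⟫_ℂ).re)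
    (hI : ∃ j, 1 ≤ j ∧ (⟪x₀ - y N, y N⟫_ℂ).re ^ 4 < ‖⟪x₀ - y N, (T ^ j) (y N)⟫_ℂ‖)
    {c : ℓ2} (hc : IsMinimal (V T hT (y N)) x₀ ‖x₀ - y N‖ c) :
    1 - gammaEps T hT u₀ (⟪x₀ - y N, y N⟫_ℂ).re ≤ ‖c 0‖ ^ 2
    ∧ ‖c 0‖ ^ 2 ≤ 1 - (98 / 100 * 10 ^ 20 * (⟪x₀ - y N, y N⟫_ℂ).re ^ 11) ^ 2
    ∧ (98 / 100 * 10 ^ 20 * (⟪x₀ - y N, y N⟫_ℂ).re ^ 11) ^ 2 ≤ ‖L c‖ ^ 2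
    ∧ ‖L c‖ ^ 2 ≤ gammaEps T hT u₀ (⟪x₀ - y N, y N⟫_ℂ).re
    ∧ (1 - gammaEps T hT u₀ (⟪x₀ - y N, y N⟫_ℂ).re) * ‖c‖ ^ 2 ≤ ‖c 0‖ ^ 2 := by
  obtain ⟨htN, -, hL2a, hL2b, hcsq, htail, -⟩ :=
    exit_controls T hT hT20 x₀ y₀ hx₀ hwin him ht0 ht1 h9 y a hy0 hy N hII hpos u₀ hu₀ hA hI hc
  have hsplit : ‖L c‖ ^ 2 = ‖c‖ ^ 2 - ‖c 0‖ ^ 2 := norm_L_apply_sq c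
  have hc1 : ‖c‖ ^ 2 ≤ 1 := by linarith only [hcsq, pow_nonneg htN.le 10]
  have htail2 : (98 / 100 * 10 ^ 20 * (⟪x₀ - y N, y N⟫_ℂ).re ^ 11) ^ 2 ≤ ‖L c‖ ^ 2 :=
    pow_le_pow_left₀ (mul_nonneg (by norm_num) (pow_nonneg htN.le 11)) htail 2
  refine ⟨hL2a, by linarith only [hsplit, hc1, htail2], htail2, hL2b, ?_⟩
  calc (1 - gammaEps T hT u₀ (⟪x₀ - y N, y N⟫_ℂ).re) * ‖c‖ ^ 2 ≤ ‖c 0‖ ^ 2 * ‖c‖ ^ 2 :=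
        mul_le_mul_of_nonneg_right hL2a (sq_nonneg ‖c‖)
    _ ≤ ‖c 0‖ ^ 2 * 1 := mul_le_mul_of_nonneg_left hc1 (sq_nonneg ‖c 0‖)
    _ = ‖c 0‖ ^ 2 := mul_one _

/-- **THE run has a first Case-I stage, or `T` has a non-trivial closed invariant subspace.**  Setting of
`exit_package` (without (9) at `y₀`).  Along THE run of (26) from `y₀`: EITHER `T` has a non-trivial closed
invariant subspace (Case II as printed at every stage — `caseI_exit_or_hasNontrivialClosedInvariantSubspace` — or a
Case II stage with `(εθ)_n = 0`, where `x₀ − y_n ≠ 0` is orthogonal to the whole orbit of `y_n ≠ 0`), OR there is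
a FIRST stage `N` with a Case I index (`|⟨x₀ − y_N, T^j y_N⟩| > ((εθ)_N)⁴`, some `j ≥ 1`), Case II as printed and
`(εθ)_n > 0` at every `n < N` — exactly the hypotheses of `exit_package` / `exit_controls`. [cite: Enflo2023, v2 p.13, tex L443–L450] -/
theorem first_caseI_stage_or_hasNontrivialClosedInvariantSubspace (T : H →L[ℂ] H) (hT : ‖T‖ < 1)
    (hT20 : ‖T‖ ≤ 1 / 10 ^ 20) (x₀ y₀ : H) (hx₀ : ‖x₀‖ = 1)
    (hwin : 0.3 ≤ ‖x₀ - y₀‖ ∧ ‖x₀ - y₀‖ ≤ 0.7) (him : (⟪x₀ - y₀, y₀⟫_ℂ).im = 0)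
    (ht0 : 0 ≤ (⟪x₀ - y₀, y₀⟫_ℂ).re) (ht1 : (⟪x₀ - y₀, y₀⟫_ℂ).re ≤ 1 / 10 ^ 4)
    (y : ℕ → H) (a : ℕ → ℓ2) (hy0 : y 0 = y₀)
    (hy : ∀ n, IsMinimal (V T hT (y n)) x₀ ‖x₀ - ((1 + (⟪x₀ - y n, y n⟫_ℂ).re / 10 : ℝ) : ℂ) • y n‖ (a n) ∧
      y (n + 1) = V T hT (y n) (a n)) :
    HasNontrivialClosedInvariantSubspace T ∨
      ∃ N, (∃ j, 1 ≤ j ∧ (⟪x₀ - y N, y N⟫_ℂ).re ^ 4 < ‖⟪x₀ - y N, (T ^ j) (y N)⟫_ℂ‖)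
        ∧ (∀ n, n < N → ∀ j, 1 ≤ j → ‖⟪x₀ - y n, (T ^ j) (y n)⟫_ℂ‖ ≤ (⟪x₀ - y n, y n⟫_ℂ).re ^ 4)
        ∧ (∀ n, n < N → 0 < (⟪x₀ - y n, y n⟫_ℂ).re) := by
  classical
  have hS := run_state T hT x₀ y₀ hx₀ hwin him ht0 y a hy0 hy
  rcases caseI_exit_or_hasNontrivialClosedInvariantSubspace T hT hT20 x₀ y₀ hx₀ hwin him ht0 ht1 y a hy0 hy
    with hex | hinv
  · have hex' : ∃ N, ∃ j, 1 ≤ j ∧ (⟪x₀ - y N, y N⟫_ℂ).re ^ 4 < ‖⟪x₀ - y N, (T ^ j) (y N)⟫_ℂ‖ := by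
      obtain ⟨n, j, hj, h⟩ := hex; exact ⟨n, j, hj, h⟩
    set N := Nat.find hex' with hN_def
    have hN : ∃ j, 1 ≤ j ∧ (⟪x₀ - y N, y N⟫_ℂ).re ^ 4 < ‖⟪x₀ - y N, (T ^ j) (y N)⟫_ℂ‖ := Nat.find_spec hex'
    have hII : ∀ n, n < N → ∀ j, 1 ≤ j → ‖⟪x₀ - y n, (T ^ j) (y n)⟫_ℂ‖ ≤ (⟪x₀ - y n, y n⟫_ℂ).re ^ 4 := by
      intro n hn j hj
      have hmin := Nat.find_min hex' hn
      exact not_lt.1 (fun hlt => hmin ⟨j, hj, hlt⟩)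
    by_cases hpos : ∀ n, n < N → 0 < (⟪x₀ - y n, y n⟫_ℂ).re
    · exact Or.inr ⟨N, hN, hII, hpos⟩
    · left
      obtain ⟨n, hn⟩ := not_forall.1 hpos
      obtain ⟨hnN, hn0⟩ := Classical.not_imp.1 hn
      have htn : (⟪x₀ - y n, y n⟫_ℂ).re = 0 := le_antisymm (not_lt.1 hn0) (hS n).1
      have ht_re : ⟪x₀ - y n, y n⟫_ℂ = (((⟪x₀ - y n, y n⟫_ℂ).re : ℝ) : ℂ) :=
        Complex.ext (by rw [Complex.ofReal_re]) (by rw [Complex.ofReal_im]; exact (hS n).2.2.1)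
      have hyn : y n ≠ 0 := ne_zero_of_norm_sub_lt_one hx₀ (by linarith only [(hS n).2.1])
      have horth : ∀ j, ⟪x₀ - y n, (T ^ j) (y n)⟫_ℂ = 0 := by
        intro j
        rcases Nat.eq_zero_or_pos j with hj | hj
        · subst hj; rw [pow_zero, one_apply_eq_self, ht_re, htn, Complex.ofReal_zero]
        · have h := hII n hnN j hj
          rw [htn] at h
          simpa using h
      exact hasNontrivialClosedInvariantSubspace_of_orbit_orthogonal' T hyn (hS n).2.2.2 horth
  · exact Or.inl hinv

end CaseII

end Literature.Analysis.OperatorTheory.Enflo2023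

end
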